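import Summits.ResolutionOfSingularities.ResolutionOfSingularities.Theorems.FloorDescent4
import Summits.ResolutionOfSingularities.ResolutionOfSingularities.Theorems.FloorCutClasses
import Summits.ResolutionOfSingularities.ResolutionOfSingularities.Theorems.MaxContactCutFloorCut
import Literature.AlgebraicGeometry.Resolution.PointBlowupFlagTranslatedStep
import HarnessLib

/-!
# FloorDescent (5/6) — §8 (L2) THE CONVERSION LAW `conversion_law` (truncated compositional inverse; `arcMonoIdeal`)

Part of the node «FloorDescent» (decomp-res · lens-5 g34): the ORDER FLOOR cell `FloorCut.NoFloorTailsDeep` of the deep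
tight-defect column DECIDED IN KERNEL for every prime `p` and exponent `e` (statement, mechanism and honest placement in
the module docstring of `FloorDescent6`; record HOME/decomp-res-lens-5/g34/NODE-g34.md).  Verbatim slice of the farm-checked
monolith `HOME/decomp-res-lens-5/g34/FloorDescent.lean` (lines 1183–1418); one namespace across the six slices.
-/

open MvPolynomial Finset
open scoped BigOperators Polynomial
open Literature.AlgebraicGeometry.Resolution
open Literature.AlgebraicGeometry.Resolution.Hauser2010
open Literature.AlgebraicGeometry.Resolution.PointBlowup
open Literature.AlgebraicGeometry.Resolution.HauserPerlega2024
open Summit.ResolutionOfSingularities.ResolutionOfSingularities.Theorems.TightDefectClasses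

namespace Summit.ResolutionOfSingularities.ResolutionOfSingularities.Theorems.FloorDescent


noncomputable section


/-! ## §8 (L2) THE CONVERSION LAW — across a change of chart index, under transversality, a `j'`-based frame is
traded for a `j`-based frame at the SAME depth (truncated compositional inverse of the arc's `y_j`-coordinate). -/

section Conversion

variable {σ : Type} [DecidableEq σ] [Fintype σ] {K : Type} [Field K]

/-- The MONOMIAL form of the `k`-th power of the arc ideal: monomials `y^d` with `m (k − |d|_{≠j}) ≤ d_j`.
[folklore] -/
def arcMonoIdeal (j : σ) (m k : ℕ) : Ideal (MvPolynomial σ K) :=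
  Ideal.span ((fun d => monomial d (1 : K)) '' {d | m * (k - offDeg j d) ≤ d j})

/-- `mem_arcMonoIdeal_iff`: Auxiliary step of this node's calculus, VERBATIM from the lens file (see the module
docstring); the statement is its type. [folklore] -/
theorem mem_arcMonoIdeal_iff (j : σ) (m k : ℕ) (G : MvPolynomial σ K) :
    G ∈ arcMonoIdeal j m k ↔ ∀ d ∈ G.support, m * (k - offDeg j d) ≤ d j := by
  rw [arcMonoIdeal, mem_ideal_span_monomial_image]
  refine ⟨fun h d hd => ?_, fun h d hd => ⟨d, h d hd, le_rfl⟩⟩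
  obtain ⟨s, hs, hsd⟩ := h d hd
  have h1 : offDeg j s ≤ offDeg j d := Finset.sum_le_sum fun i _ => hsd i
  have h2 : s j ≤ d j := hsd j
  have h3 : m * (k - offDeg j d) ≤ m * (k - offDeg j s) := Nat.mul_le_mul_left _ (by omega)
  exact le_trans h3 (le_trans (by exact hs) h2)

/-- `(y_j^m, y_{≠ j})^k` is contained in its monomial form. [folklore] -/
theorem arcIdeal_pow_le (j : σ) (m k : ℕ) : (arcIdeal j m : Ideal (MvPolynomial σ K)) ^ k ≤ arcMonoIdeal j m k := by
  induction k with
  | zero =>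
    rw [pow_zero, Ideal.one_eq_top, top_le_iff, Ideal.eq_top_iff_one]
    refine Ideal.subset_span ⟨0, ?_, by simp⟩
    show m * (0 - offDeg j 0) ≤ (0 : σ →₀ ℕ) j
    simp
  | succ k ih =>
    rw [pow_succ]
    refine le_trans (Ideal.mul_mono_left ih) ?_
    rw [arcMonoIdeal, arcIdeal, Ideal.span_mul_span', Ideal.span_le]
    rintro _ ⟨x, ⟨d, hd, rfl⟩, y, hy, rfl⟩
    have hd : m * (k - offDeg j d) ≤ d j := hd
    beta_reduce
    rcases hy with rfl | ⟨i, hi, rfl⟩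
    · rw [X_pow_eq_monomial, monomial_mul, one_mul]
      refine Ideal.subset_span ⟨_, ?_, rfl⟩
      show m * (k + 1 - offDeg j (d + Finsupp.single j m)) ≤ (d + Finsupp.single j m) j
      rw [offDeg_add, offDeg_single_self, add_zero, Finsupp.add_apply, Finsupp.single_eq_same]
      have : m * (k + 1 - offDeg j d) ≤ m * (k - offDeg j d) + m := by
        rw [← Nat.mul_succ]; exact Nat.mul_le_mul_left _ (by omega)
      omega
    · have hi : i ≠ j := hi
      beta_reduce
      rw [← pow_one (X i : MvPolynomial σ K), X_pow_eq_monomial, monomial_mul, one_mul]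
      refine Ideal.subset_span ⟨_, ?_, rfl⟩
      show m * (k + 1 - offDeg j (d + Finsupp.single i (1 : ℕ))) ≤ (d + Finsupp.single i (1 : ℕ)) j
      rw [offDeg_add, offDeg_single_ne j hi, Finsupp.add_apply, Finsupp.single_apply, if_neg hi, add_zero]
      have : k + 1 - (offDeg j d + 1) = k - offDeg j d := by omega
      rw [this]; exact hd

/-- **An arc monomial lies in the power of the arc ideal**: `m (k − |d|_{≠j}) ≤ d_j ⇒ y^d ∈ (y_j^m, y_{≠j})^k`.
[folklore] -/
theorem monomial_mem_arcIdeal_pow (j : σ) {m k : ℕ} {d : σ →₀ ℕ} (hd : m * (k - offDeg j d) ≤ d j) (c : K) :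
    (monomial d c : MvPolynomial σ K) ∈ (arcIdeal j m) ^ k := by
  have hmon : (monomial d c : MvPolynomial σ K) = C c * (X j ^ d j * ∏ i ∈ univ.erase j, X i ^ d i) := by
    rw [monomial_eq, Finsupp.prod_fintype _ _ (fun i => pow_zero _), ← Finset.mul_prod_erase _ _ (mem_univ j)]
  rw [hmon]
  refine Ideal.mul_mem_left _ _ ?_
  have h1 : ∏ i ∈ univ.erase j, (X i : MvPolynomial σ K) ^ d i ∈ (arcIdeal j m) ^ offDeg j d := by
    unfold offDeg
    exact prod_pow_mem_pow _ _ (fun i => (X i : MvPolynomial σ K)) (fun i => d i)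
      fun i hi => X_mem_arcIdeal j m (ne_of_mem_erase hi)
  have h2 : (X j : MvPolynomial σ K) ^ d j ∈ (arcIdeal j m) ^ (k - offDeg j d) := by
    obtain ⟨t, ht⟩ : ∃ t, d j = m * (k - offDeg j d) + t := ⟨_, (Nat.add_sub_cancel' hd).symm⟩
    rw [ht, pow_add, pow_mul]
    exact Ideal.mul_mem_right _ _ (Ideal.pow_mem_pow (X_pow_mem_arcIdeal j m) _)
  have h3 := Ideal.mul_mem_mul h2 h1
  rw [← pow_add] at h3
  exact Ideal.pow_le_pow_right (by omega) h3

/-- **The arc condition puts the CLEANED part in the power of the arc ideal.** [folklore] -/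
theorem deletePthPowers_mem_arcIdeal_pow {j : σ} {q m : ℕ} {G : MvPolynomial σ K} (hG : ArcCond j q m G) :
    deletePthPowers q G ∈ (arcIdeal j m : Ideal (MvPolynomial σ K)) ^ q := by
  rw [(deletePthPowers q G).as_sum]
  refine Ideal.sum_mem _ fun d hd => ?_
  have hnot := not_isPthPowerExponent_of_mem_support_deletePthPowers hd
  have hdG : d ∈ G.support := by
    rw [MvPolynomial.mem_support_iff, coeff_deletePthPowers, if_neg hnot] at hd
    exact MvPolynomial.mem_support_iff.mpr hd
  rcases hG d hdG with h | h
  · exact absurd h hnot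
  · exact monomial_mem_arcIdeal_pow j h _

/-- **NEWTON: truncated compositional right inverse** of a one-variable polynomial with `φ(0) = 0`,
`φ'(0) ≠ 0`: for every `n` there is `ψ` with `ψ(0) = 0` and `φ ∘ ψ ≡ X (mod X^n)`. [folklore] -/
theorem exists_comp_right_inverse_trunc (φ : K[X]) (h0 : φ.coeff 0 = 0) (h1 : φ.coeff 1 ≠ 0) (n : ℕ) :
    ∃ ψ : K[X], ψ.coeff 0 = 0 ∧ Polynomial.X ^ n ∣ φ.comp ψ - Polynomial.X := by
  induction n with
  | zero => exact ⟨0, Polynomial.coeff_zero 0, by rw [pow_zero]; exact one_dvd _⟩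
  | succ n ih =>
    rcases Nat.eq_zero_or_pos n with hn | hn
    · subst hn
      refine ⟨0, Polynomial.coeff_zero 0, ?_⟩
      rw [Polynomial.comp_zero, ← Polynomial.coeff_zero_eq_eval_zero, h0, map_zero, zero_sub, pow_one]
      exact dvd_neg.mpr (dvd_refl _)
    obtain ⟨ψ, hψ0, g, hg⟩ := ih
    obtain ⟨n', rfl⟩ : ∃ n', n = n' + 1 := ⟨n - 1, by omega⟩
    set a := φ.coeff 1 with ha
    set c : K := -(g.coeff 0) / a with hc
    set y : K[X] := Polynomial.C c * Polynomial.X ^ (n' + 1) with hy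
    -- Taylor expansion to second order: φ(ψ + y) = φ(ψ) + φ'(ψ) y + k y²
    obtain ⟨k, hk⟩ := Polynomial.binomExpansion (φ.map Polynomial.C) ψ y
    have hcomp : ∀ χ : K[X], φ.comp χ = (φ.map Polynomial.C).eval χ := fun χ => by
      rw [Polynomial.eval_map]; rfl
    have hcomp' : ∀ χ : K[X], (Polynomial.derivative φ).comp χ
        = (Polynomial.derivative (φ.map Polynomial.C)).eval χ := fun χ => by
      rw [Polynomial.derivative_map, Polynomial.eval_map]; rfl
    -- φ'(ψ) ≡ a (mod X)
    have hφ'0 : ((Polynomial.derivative φ).comp ψ).coeff 0 = a := by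
      rw [Polynomial.coeff_zero_eq_eval_zero, Polynomial.eval_comp, ← Polynomial.coeff_zero_eq_eval_zero, hψ0,
        ← Polynomial.coeff_zero_eq_eval_zero, Polynomial.coeff_derivative, ha]
      simp
    obtain ⟨g₂, hg₂⟩ : Polynomial.X ∣ (Polynomial.derivative φ).comp ψ - Polynomial.C a := by
      rw [← hφ'0]; exact Polynomial.X_dvd_sub_C
    obtain ⟨g₃, hg₃⟩ : Polynomial.X ∣ g + Polynomial.C a * Polynomial.C c := by
      rw [Polynomial.X_dvd_iff, Polynomial.coeff_add, ← map_mul, Polynomial.coeff_C_zero, hc,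
        mul_div_cancel₀ _ h1, add_neg_cancel]
    refine ⟨ψ + y, ?_, g₃ + g₂ * Polynomial.C c + k * Polynomial.C c ^ 2 * Polynomial.X ^ n', ?_⟩
    · rw [Polynomial.coeff_add, hψ0, hy, Polynomial.coeff_C_mul, Polynomial.coeff_X_pow, if_neg (by omega),
        mul_zero, add_zero]
    · rw [hcomp, hk, ← hcomp, ← hcomp']
      have e1 : φ.comp ψ = Polynomial.X + Polynomial.X ^ (n' + 1) * g := by rw [← hg]; ring
      have e2 : (Polynomial.derivative φ).comp ψ = Polynomial.C a + Polynomial.X * g₂ := by rw [← hg₂]; ring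
      have e3 : g = Polynomial.X * g₃ - Polynomial.C a * Polynomial.C c := by rw [← hg₃]; ring
      rw [e1, e2, e3, hy]
      ring

/-- Composition with an arc vanishing at `0` vanishes at `0`. [folklore] -/
theorem coeff_zero_comp_eq_zero (f ψ : K[X]) (hf : f.coeff 0 = 0) (hψ : ψ.coeff 0 = 0) : (f.comp ψ).coeff 0 = 0 := by
  rw [Polynomial.coeff_zero_eq_eval_zero, Polynomial.eval_comp, ← Polynomial.coeff_zero_eq_eval_zero, hψ,
    ← Polynomial.coeff_zero_eq_eval_zero, hf]

omit [DecidableEq σ] [Fintype σ] in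
/-- `aeval` of a one-variable polynomial changes by a multiple of the difference of the arguments. [folklore] -/
theorem sub_dvd_aeval_sub (x y : MvPolynomial σ K) (f : K[X]) :
    x - y ∣ Polynomial.aeval x f - Polynomial.aeval y f := by
  rw [Polynomial.aeval_def, Polynomial.aeval_def, ← Polynomial.eval_map, ← Polynomial.eval_map]
  exact Polynomial.sub_dvd_eval_sub x y _

omit [DecidableEq σ] [Fintype σ] in
/-- A line polynomial of an arc vanishing at `0` is divisible by `y_j`. [folklore] -/
theorem X_dvd_toLine (j : σ) {ψ : K[X]} (hψ : ψ.coeff 0 = 0) : (X j : MvPolynomial σ K) ∣ toLine j ψ := by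
  obtain ⟨ψ₁, h⟩ := Polynomial.X_dvd_iff.mpr hψ
  rw [h, map_mul, toLine_X]
  exact dvd_mul_right _ _

/-- **(L2) THE CONVERSION LAW.**  If a `j'`-based frame `frame_{j'}(p')` (arc `y_i = p'_i(y_{j'})`) puts `H` in arc
condition of depth `m`, and the arc is TRANSVERSAL to `y_j = 0` (`p'_j` has a non-zero linear term; `j ≠ j'`),
then some `j`-based frame puts `H` in arc condition of the same depth `m`: re-parametrise the arc by `y_j`
through a truncated compositional inverse `ψ` of `p'_j` (`p'_j ∘ ψ ≡ y_j mod y_j^m`).  CONSUMES: transversality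
`b_{t+1}(j_t) ≠ 0` (from (L3)); characteristic `p`, `q = p^e` (frames preserve `K[y^q]`). [folklore] -/
theorem conversion_law {p : ℕ} [Fact p.Prime] [CharP K p] (e : ℕ) {j j' : σ} (hjj' : j' ≠ j) (m : ℕ)
    (p' : σ → K[X]) (hp'0 : ∀ i, (p' i).coeff 0 = 0) (htr : (p' j).coeff 1 ≠ 0) {H : MvPolynomial σ K}
    (harc : ArcCond j' (p ^ e) m (frame j' p' H)) :
    ∃ r : σ → K[X], (∀ i, (r i).coeff 0 = 0) ∧ ArcCond j (p ^ e) m (frame j r H) := by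
  set q := p ^ e with hq
  obtain ⟨ψ, hψ0, gψ, hgψ⟩ := exists_comp_right_inverse_trunc (p' j) (hp'0 j) htr m
  set r : σ → K[X] := fun i => if i = j' then ψ else (p' i).comp ψ with hr
  have hr0 : ∀ i, (r i).coeff 0 = 0 := fun i => by
    by_cases hi : i = j'
    · show (if i = j' then ψ else (p' i).comp ψ).coeff 0 = 0
      rw [if_pos hi]; exact hψ0
    · show (if i = j' then ψ else (p' i).comp ψ).coeff 0 = 0
      rw [if_neg hi]; exact coeff_zero_comp_eq_zero _ _ (hp'0 i) hψ0
  refine ⟨r, hr0, ?_⟩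
  set T := frame j r with hT
  set S'inv := frame j' (-p') with hS'inv
  set TS : MvPolynomial σ K →+* MvPolynomial σ K := (T.comp S'inv : MvPolynomial σ K →+* MvPolynomial σ K)
    with hTS
  have hTj' : T (X j') = X j' + toLine j ψ := by
    rw [hT, frame_X_ne j r hjj']
    show X j' + toLine j (if j' = j' then ψ else (p' j').comp ψ) = _
    rw [if_pos rfl]
  -- the key ideal inclusion `T(S'⁻¹(𝔞')) ⊆ 𝔞`
  have hincl : (arcIdeal j' m).map TS ≤ (arcIdeal j m : Ideal (MvPolynomial σ K)) := by
    rw [arcIdeal, Ideal.map_span, Ideal.span_le]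
    rintro _ ⟨x, hx, rfl⟩
    rw [SetLike.mem_coe, hTS, RingHom.coe_coe, AlgHom.comp_apply, hS'inv]
    rcases hx with rfl | ⟨i, hi, rfl⟩
    · -- `T(y_{j'})^m = (y_{j'} + ψ(y_j))^m ≡ ψ(y_j)^m ∈ (y_j^m)`
      rw [frame_X_pow_self, map_pow, hTj']
      obtain ⟨t, ht⟩ := sub_dvd_pow_sub_pow (X j' + toLine j ψ) (toLine j ψ) m
      rw [add_sub_cancel_right] at ht
      have : (X j' + toLine j ψ) ^ m = toLine j ψ ^ m + X j' * t := by rw [← ht]; ring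
      rw [this]
      refine Ideal.add_mem _ ?_ (Ideal.mul_mem_right _ _ (X_mem_arcIdeal j m hjj'))
      obtain ⟨u, hu⟩ := X_dvd_toLine j hψ0
      rw [hu, mul_pow]
      exact Ideal.mul_mem_right _ _ (X_pow_mem_arcIdeal j m)
    · have hi : i ≠ j' := hi
      rw [frame_X_ne j' _ hi, Pi.neg_apply, map_neg, map_add, map_neg, toLine,
        ← Polynomial.aeval_algHom_apply, hTj']
      -- `p'_i(y_{j'} + ψ) ≡ p'_i(ψ)` modulo `y_{j'} ∈ 𝔞`
      obtain ⟨v, hv⟩ := sub_dvd_aeval_sub (X j' + toLine j ψ) (toLine j ψ) (p' i)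
      rw [add_sub_cancel_right] at hv
      have hsplit : Polynomial.aeval (X j' + toLine j ψ) (p' i)
          = toLine j ((p' i).comp ψ) + X j' * v := by
        rw [← hv, toLine, Polynomial.aeval_comp]; ring
      rw [hsplit, neg_add, ← add_assoc]
      refine Ideal.add_mem _ ?_ ((Ideal.neg_mem_iff _).mpr (Ideal.mul_mem_right _ _ (X_mem_arcIdeal j m hjj')))
      by_cases hij : i = j
      · -- transversal coordinate: `y_j − (p'_j ∘ ψ)(y_j) = −y_j^m gψ(y_j)`
        rw [hij, hT, frame_X_self]
        have : (p' j).comp ψ = Polynomial.X + Polynomial.X ^ m * gψ := by rw [← hgψ]; ring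
        rw [this, map_add, toLine_X, map_mul, map_pow, toLine_X, neg_add, ← add_assoc, add_neg_cancel, zero_add]
        exact (Ideal.neg_mem_iff _).mpr (Ideal.mul_mem_right _ _ (X_pow_mem_arcIdeal j m))
      · rw [hT, frame_X_ne j r hij]
        show X i + toLine j (if i = j' then ψ else (p' i).comp ψ) + -toLine j ((p' i).comp ψ) ∈ _
        rw [if_neg hi, add_neg_cancel_right]
        exact X_mem_arcIdeal j m hij
  -- decompose `frame_{j'}(p') H` = cleaned part (in `𝔞'^q`) + `q`-power part, and map through `T ∘ S'⁻¹`
  set G := frame j' p' H with hG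
  have hH : T H = TS (deletePthPowers q G) + TS (G - deletePthPowers q G) := by
    rw [← map_add, add_sub_cancel, hTS, RingHom.coe_coe, AlgHom.comp_apply, hS'inv, hG, frame_neg_frame]
  have hA : TS (deletePthPowers q G) ∈ arcMonoIdeal j m q := by
    refine arcIdeal_pow_le j m q ?_
    have := Ideal.mem_map_of_mem TS (deletePthPowers_mem_arcIdeal_pow harc)
    rw [Ideal.map_pow] at this
    exact Ideal.pow_right_mono hincl q this
  have hB : IsQPow q (TS (G - deletePthPowers q G)) := by
    rw [hTS, RingHom.coe_coe]
    exact (isQPow_sub_deletePthPowers q G).map_algHom _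
  rw [mem_arcMonoIdeal_iff] at hA
  intro d hd
  rw [hH] at hd
  rcases Finset.mem_union.mp (support_add hd) with h | h
  · exact Or.inr (hA d h)
  · exact Or.inl (hB d h)

end Conversion

end

end Summit.ResolutionOfSingularities.ResolutionOfSingularities.Theorems.FloorDescent
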